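import Literature.Analysis.FluidPDE.OseenDuhamelDifferentiation
import Literature.Analysis.FluidPDE.OseenSliceHolderTwoConstant
import Literature.Analysis.FluidPDE.FractionalGronwall
import HarnessLib

/-!
# Weighted Hölder and `𝒞^{1,κ}` bounds for Oseen–Duhamel terms with power-profile data

Analysis/FluidPDE support file (everything proved; no definitions, no named facts) on the proof
path of the corrected perturbation theorem of M. P. Coiculescu, S. Palasek, Invent. Math. 244
(2025), arXiv:2503.14699, Props. 4.2–4.3 (hypothesis `hB`, `κ ≤ α`, of
`Literature.Barriers.NavierStokesRegularity.CoiculescuPalasek2025_construction_of_parts'`).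

The correction `w` of Prop. 4.3 solves the mild equation
`w = 𝒟[F] - B(ṽ, w) - B(w, ṽ) - B(w, w)` (`B = oseenDuhamel 1 0`,
`CP25PerturbationPicard.lean`), in which every Duhamel term `B(u,v)(t) = ∫₀ᵗ N_{t-τ}[u(τ),v(τ)]dτ`
has data with **power profiles in time**: sup norms with `‖u(τ)‖‖v(τ)‖ ≤ P τ^{a-1}` and Hölder
constants (exponent `γ`) with `[u(τ)]_γ‖v(τ)‖ + ‖u(τ)‖[v(τ)]_γ ≤ Q τ^{a-1-γ/2}` (`a = α`: the
pairs `(ṽ, w)`, `(w, ṽ)`, `(w, w)`, `(eₘ, Fₘ)`). For such a pair this file proves, on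
`0 < t ≤ 1`:

* `norm_oseenDuhamel_sub_le_of_profile` — `[B(u,v)(t)]_{γ'} ≤ C P (2/a + 4/(1-γ')) t^{a-1/2-γ'/2}`
  for `0 ≤ γ' < 1` (kernel form of the slice modulus, `exists_oseenSlice_sub_le_of_bound`);
* `hasFDerivAt_oseenDuhamel_of_profile`, `norm_fderiv_oseenDuhamel_le_of_profile` —
  `B(u,v)(t)` is differentiable with `‖D B(u,v)(t)‖ ≤ C (P/a + Q/γ) t^{a-1}`;
* `norm_fderiv_oseenDuhamel_sub_le_of_profile` —
  `[D B(u,v)(t)]_κ ≤ C (P/a + Q/(γ-κ)) t^{a-1-κ/2}` for `0 ≤ κ < γ`.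

The time integral is split at `τ = t/2` (as the terms I–II / III in the proof of Prop. 4.2 of
the paper): for `τ < t/2` the kernel absorbs the derivative and the Hölder difference
(`‖DN_σ‖ ≤ C₁σ⁻¹MM`, `[DN_σ]_κ ≤ Cσ^{-1-κ/2}MM`, `exists_norm_fderiv_oseenSlice_le`,
`exists_norm_fderiv_oseenSlice_sub_le`), for `τ > t/2` they fall on the `γ`-Hölder data
(`‖DN_σ‖ ≤ Cσ^{-1+γ/2}(H_uM_v + M_uH_v)`, `[DN_σ]_κ ≤ 2Cσ^{-1+(γ-κ)/2}(H_uM_v + M_uH_v)`,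
`exists_holder_fderiv_oseenSlice_sub_le_two`), and the integrals are elementary. The output
exponents are those of parabolic scaling (`amplitude t^{a-1/2}`, length `t^{1/2}`), which is what
makes the `X`-norm bookkeeping of Prop. 4.3 close when `κ ≤ α`.

## References

* M. P. Coiculescu, S. Palasek, Invent. Math. 244 (2025) = arXiv:2503.14699, §2.3 Lemma 2.2 (2.5),
  proof of Prop. 4.2 (terms I–III), proof of Prop. 4.3. [CoiculescuPalasek2025]
-/

noncomputable section

open MeasureTheory Set Function Filter Metric Real
open _root_.Topology
open scoped ENNReal NNReal RealInnerProductSpace ContDiff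

namespace Literature.Analysis.FluidPDE

/-! ### Elementary integrals on the two halves of `(0, t)` -/

section Halves

/-- `∫_{(0,t/2)} τ^{a-1} dτ = (t/2)^a / a` for `0 < a`. [folklore] -/
theorem setIntegral_Ioo_half_rpow {t a : ℝ} (ht : 0 < t) (ha : 0 < a) :
    ∫ τ in Ioo 0 (t / 2), τ ^ (a - 1) = (t / 2) ^ a / a := by
  have h := setIntegral_Ioo_rpow_neg (b := t / 2) (β := 1 - a) (by positivity) (by linarith)
  have e1 : (fun τ : ℝ => τ ^ (-(1 - a))) = fun τ => τ ^ (a - 1) := by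
    funext τ; congr 1; ring
  rw [e1] at h
  rw [h]
  congr 1
  · congr 1; ring
  · ring

/-- `∫_{(t/2,t)} (t-τ)^{e} dτ = (t/2)^{e+1}/(e+1)` for `-1 < e`. [folklore] -/
theorem setIntegral_Ioo_half_sub_rpow {t e : ℝ} (ht : 0 < t) (he : -1 < e) :
    ∫ τ in Ioo (t / 2) t, (t - τ) ^ e = (t / 2) ^ (e + 1) / (e + 1) := by
  have h := setIntegral_Ioo_sub_rpow_neg (c := t / 2) (t := t) (a := -e) (by linarith) (by linarith)
  simp only [neg_neg] at h
  rw [h]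
  have e1 : t - t / 2 = t / 2 := by ring
  rw [e1]
  congr 1
  · congr 1; ring
  · ring

/-- `(t/2)^e ≤ 4 t^e` for `-2 ≤ e`, `0 < t`. [folklore] -/
theorem half_rpow_le_four_mul {t e : ℝ} (ht : 0 < t) (he : -2 ≤ e) :
    (t / 2) ^ e ≤ 4 * t ^ e := by
  rw [div_eq_mul_inv, Real.mul_rpow ht.le (by norm_num), mul_comm]
  refine mul_le_mul_of_nonneg_right ?_ (Real.rpow_nonneg ht.le _)
  rw [Real.inv_rpow (by norm_num : (0:ℝ) ≤ 2), ← Real.rpow_neg (by norm_num : (0:ℝ) ≤ 2)]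
  calc (2 : ℝ) ^ (-e) ≤ 2 ^ (2 : ℝ) := Real.rpow_le_rpow_of_exponent_le one_le_two (by linarith)
    _ = 4 := by norm_num

end Halves

/-! ### The Duhamel term with power-profile data -/

section Profile

variable {E : Type*} [NormedAddCommGroup E] [InnerProductSpace ℝ E] [FiniteDimensional ℝ E]
  [MeasurableSpace E] [BorelSpace E]

/-- The Abel weight of a pair with `‖u(τ)‖‖v(τ)‖ ≤ P τ^{a-1}`: `(t-τ)^{-1/2} M_u(τ)M_v(τ)` is
integrable on `(0, t)`. [folklore] -/
theorem integrableOn_weight_of_profile {t a P : ℝ} (ht : 0 < t) (ha : 0 < a) (ha1 : a ≤ 1)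
    {Mu Mv : ℝ → ℝ} (hMum : Measurable Mu) (hMvm : Measurable Mv)
    (hMu0 : ∀ τ ∈ Ioo 0 t, 0 ≤ Mu τ) (hMv0 : ∀ τ ∈ Ioo 0 t, 0 ≤ Mv τ)
    (hP : ∀ τ ∈ Ioo 0 t, Mu τ * Mv τ ≤ P * τ ^ (a - 1)) :
    IntegrableOn (fun τ => (t - τ) ^ (-(1 / 2 : ℝ)) * (Mu τ * Mv τ)) (Ioo 0 t) volume := by
  obtain ⟨hint, -⟩ := setIntegral_abel_rpow_rpow_le (a := 1 / 2) (b := 1 - a) (t := t)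
    (by norm_num) (by norm_num) (by linarith) (by linarith) ht
  have hmeas : AEStronglyMeasurable (fun τ => (t - τ) ^ (-(1 / 2 : ℝ)) * (Mu τ * Mv τ))
      (volume.restrict (Ioo 0 t)) :=
    (((measurable_const.sub measurable_id).pow_const _).mul (hMum.mul hMvm)).aestronglyMeasurable
  refine Integrable.mono' (hint.const_mul P) hmeas ?_
  refine (ae_restrict_iff' measurableSet_Ioo).2 (Eventually.of_forall fun τ hτ => ?_)
  have h1 : 0 ≤ (t - τ) ^ (-(1 / 2 : ℝ)) := Real.rpow_nonneg (by linarith [hτ.2]) _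
  rw [Real.norm_eq_abs, abs_of_nonneg (mul_nonneg h1 (mul_nonneg (hMu0 τ hτ) (hMv0 τ hτ)))]
  have e1 : τ ^ (-(1 - a)) = τ ^ (a - 1) := by congr 1; ring
  calc (t - τ) ^ (-(1 / 2 : ℝ)) * (Mu τ * Mv τ) ≤ (t - τ) ^ (-(1 / 2 : ℝ)) * (P * τ ^ (a - 1)) :=
        mul_le_mul_of_nonneg_left (hP τ hτ) h1
    _ = P * ((t - τ) ^ (-(1 / 2 : ℝ)) * τ ^ (-(1 - a))) := by rw [e1]; ring

/-- **Hölder modulus of a Duhamel term with power-profile data** (kernel form): there is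
`C = C(E)` such that for `0 < t`, `0 < a ≤ 1`, `0 ≤ γ' < 1` and a pair with
`‖u(τ)‖‖v(τ)‖ ≤ Pτ^{a-1}` on `(0,t)`,
`‖B(u,v)(t)(x) - B(u,v)(t)(x')‖ ≤ C P (2/a + 2/(1/2 - γ'/2)) t^{a-1/2-γ'/2} ‖x - x'‖^{γ'}`.
This is the `𝒞^{γ'}` control of `w(t)` in the proof of Prop. 4.3, before the `𝒞^{1,κ}` step.
[cite: CoiculescuPalasek2025, §2.3 Lemma 2.2 (2.5) and the proof of Prop. 4.3] -/
theorem exists_norm_oseenDuhamel_sub_le_of_profile :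
    ∃ C : ℝ, 0 ≤ C ∧ ∀ {u v : ℝ → E → E}, Measurable (uncurry u) → Measurable (uncurry v) →
      ∀ {t a γ' P : ℝ}, 0 < t → 0 < a → a ≤ 1 → 0 ≤ γ' → γ' < 1 → 0 ≤ P →
      ∀ {Mu Mv : ℝ → ℝ}, Measurable Mu → Measurable Mv →
      (∀ τ ∈ Ioo 0 t, ∀ y, ‖u τ y‖ ≤ Mu τ) → (∀ τ ∈ Ioo 0 t, ∀ y, ‖v τ y‖ ≤ Mv τ) →
      (∀ τ ∈ Ioo 0 t, Mu τ * Mv τ ≤ P * τ ^ (a - 1)) → ∀ x x',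
        ‖oseenDuhamel 1 0 u v t x - oseenDuhamel 1 0 u v t x'‖ ≤
          C * P * (2 / a + 2 / (1 / 2 - γ' / 2)) * t ^ (a - 1 / 2 - γ' / 2) * ‖x - x'‖ ^ γ' := by
  obtain ⟨C, hC, hS⟩ := exists_oseenSlice_sub_le_of_bound (E := E)
  refine ⟨C, hC, fun {u v} hum hvm {t a γ' P} ht ha ha1 hγ0 hγ1 hP0 {Mu Mv} hMum hMvm hu hv hP x x' =>
    ?_⟩
  have hMu0 : ∀ τ ∈ Ioo 0 t, 0 ≤ Mu τ := fun τ hτ => (norm_nonneg _).trans (hu τ hτ x)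
  have hMv0 : ∀ τ ∈ Ioo 0 t, 0 ≤ Mv τ := fun τ hτ => (norm_nonneg _).trans (hv τ hτ x)
  have hdom := integrableOn_weight_of_profile ht ha ha1 hMum hMvm hMu0 hMv0 hP
  -- the slice modulus `m(τ) = C (t-τ)^{-1/2-γ'/2} M_u M_v ≤ C P (t-τ)^{-1/2-γ'/2} τ^{a-1}`
  obtain ⟨hint, hle⟩ := setIntegral_abel_rpow_rpow_le (a := 1 / 2 + γ' / 2) (b := 1 - a) (t := t)
    (by linarith) (by linarith) (by linarith) (by linarith) ht
  set m : ℝ → ℝ := fun τ => C * P * ((t - τ) ^ (-(1 / 2 + γ' / 2)) * τ ^ (-(1 - a))) with hm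
  have hmi : IntegrableOn m (Ioo 0 t) volume := hint.const_mul (C * P)
  have hmb : ∀ τ ∈ Ioo 0 t, ∀ y y', ‖oseenSlice (1 * (t - τ)) (u τ) (v τ) y -
      oseenSlice (1 * (t - τ)) (u τ) (v τ) y'‖ ≤ m τ * ‖y - y'‖ ^ γ' := by
    intro τ hτ y y'
    have hσ : 0 < 1 * (t - τ) := by linarith [hτ.2]
    have h := hS hσ hγ0 hγ1.le (hum.comp (measurable_const.prodMk measurable_id))
      (hvm.comp (measurable_const.prodMk measurable_id)) (hu τ hτ) (hv τ hτ) y y'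
    refine h.trans (mul_le_mul_of_nonneg_right ?_ (Real.rpow_nonneg (norm_nonneg _) _))
    rw [one_mul]
    have hk : 0 ≤ C * (t - τ) ^ (-(1 / 2 : ℝ) - γ' / 2) :=
      mul_nonneg hC (Real.rpow_nonneg (by linarith [hτ.2]) _)
    have e1 : τ ^ (-(1 - a)) = τ ^ (a - 1) := by congr 1; ring
    have e2 : (t - τ) ^ (-(1 / 2 + γ' / 2)) = (t - τ) ^ (-(1 / 2 : ℝ) - γ' / 2) := by congr 1; ring
    calc C * (t - τ) ^ (-(1 / 2 : ℝ) - γ' / 2) * Mu τ * Mv τ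
        = C * (t - τ) ^ (-(1 / 2 : ℝ) - γ' / 2) * (Mu τ * Mv τ) := by ring
      _ ≤ C * (t - τ) ^ (-(1 / 2 : ℝ) - γ' / 2) * (P * τ ^ (a - 1)) :=
          mul_le_mul_of_nonneg_left (hP τ hτ) hk
      _ = m τ := by simp only [hm]; rw [e1, e2]; ring
  have key := norm_oseenDuhamel_sub_le hum hvm hu hv hdom hmb hmi x x'
  refine key.trans (mul_le_mul_of_nonneg_right ?_ (Real.rpow_nonneg (norm_nonneg _) _))
  calc ∫ τ in Ioo 0 t, m τ = C * P * ∫ τ in Ioo 0 t, (t - τ) ^ (-(1 / 2 + γ' / 2)) * τ ^ (-(1 - a)) :=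
        integral_const_mul _ _
    _ ≤ C * P * ((2 / (1 - (1 - a)) + 2 / (1 - (1 / 2 + γ' / 2))) * t ^ (1 - (1 / 2 + γ' / 2) - (1 - a))) :=
        mul_le_mul_of_nonneg_left hle (by positivity)
    _ = C * P * (2 / a + 2 / (1 / 2 - γ' / 2)) * t ^ (a - 1 / 2 - γ' / 2) := by
        have e1 : (1 - (1 - a) : ℝ) = a := by ring
        have e2 : (1 - (1 / 2 + γ' / 2) : ℝ) = 1 / 2 - γ' / 2 := by ring
        have e3 : (1 - (1 / 2 + γ' / 2) - (1 - a) : ℝ) = a - 1 / 2 - γ' / 2 := by ring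
        rw [e3, e1, e2]; ring

/-- **Derivative and `𝒞^{1,κ}` bounds of a Duhamel term with power-profile data.** There is
`C = C(E)` such that for `0 < t ≤ 1`, `0 < a ≤ 1`, `0 < γ ≤ 1`, `0 ≤ κ < γ`, and a pair of jointly
measurable fields with continuous slices obeying on `(0, t)`

  `‖u(τ)‖ ≤ M_u(τ)`, `‖v(τ)‖ ≤ M_v(τ)`, `[u(τ)]_γ ≤ H_u(τ)`, `[v(τ)]_γ ≤ H_v(τ)`,
  `M_uM_v ≤ P τ^{a-1}`, `H_uM_v + M_uH_v ≤ Q τ^{a-1-γ/2}`,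

the Duhamel term `B(u,v)(t)` is differentiable at every point, with
`‖D B(u,v)(t)(x)‖ ≤ C (P/a + Q/γ) t^{a-1}` and
`‖D B(u,v)(t)(x) - D B(u,v)(t)(x')‖ ≤ C (P/a + Q/(γ-κ)) t^{a-1-κ/2} ‖x - x'‖^κ`
(split at `τ = t/2`: kernel forms for `τ < t/2`, the two-constant Hölder gain for `τ > t/2`). This
is the `𝒞^{1,κ}` half of the `X`-norm estimate of Prop. 4.3, term by term.
[cite: CoiculescuPalasek2025, proof of Prop. 4.2 (terms I–III) and proof of Prop. 4.3 (‖T(w)(t)‖_{𝒞^{1,κ}})] -/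
theorem exists_fderiv_oseenDuhamel_bounds_of_profile :
    ∃ C : ℝ, 0 ≤ C ∧ ∀ {u v : ℝ → E → E}, Measurable (uncurry u) → Measurable (uncurry v) →
      ∀ {t a γ κ P Q : ℝ}, 0 < t → t ≤ 1 → 0 < a → a ≤ 1 → 0 < γ → γ ≤ 1 → 0 ≤ κ → κ < γ →
      0 ≤ P → 0 ≤ Q →
      ∀ {Mu Mv Hu Hv : ℝ → ℝ}, Measurable Mu → Measurable Mv → Measurable Hu → Measurable Hv →
      (∀ τ ∈ Ioo 0 t, Continuous (u τ)) → (∀ τ ∈ Ioo 0 t, Continuous (v τ)) →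
      (∀ τ ∈ Ioo 0 t, ∀ y, ‖u τ y‖ ≤ Mu τ) → (∀ τ ∈ Ioo 0 t, ∀ y, ‖v τ y‖ ≤ Mv τ) →
      (∀ τ ∈ Ioo 0 t, 0 ≤ Hu τ) → (∀ τ ∈ Ioo 0 t, 0 ≤ Hv τ) →
      (∀ τ ∈ Ioo 0 t, ∀ y y', ‖u τ y - u τ y'‖ ≤ Hu τ * ‖y - y'‖ ^ γ) →
      (∀ τ ∈ Ioo 0 t, ∀ y y', ‖v τ y - v τ y'‖ ≤ Hv τ * ‖y - y'‖ ^ γ) →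
      (∀ τ ∈ Ioo 0 t, Mu τ * Mv τ ≤ P * τ ^ (a - 1)) →
      (∀ τ ∈ Ioo 0 t, Hu τ * Mv τ + Mu τ * Hv τ ≤ Q * τ ^ (a - 1 - γ / 2)) →
      (∀ x, HasFDerivAt (fun y => oseenDuhamel 1 0 u v t y)
          (∫ τ in Ioo 0 t, fderiv ℝ (oseenSlice (1 * (t - τ)) (u τ) (v τ)) x) x) ∧
      (∀ x, ‖fderiv ℝ (fun y => oseenDuhamel 1 0 u v t y) x‖ ≤ C * (P / a + Q / γ) * t ^ (a - 1)) ∧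
      (∀ x x', ‖fderiv ℝ (fun y => oseenDuhamel 1 0 u v t y) x -
          fderiv ℝ (fun y => oseenDuhamel 1 0 u v t y) x'‖ ≤
          C * (P / a + Q / (γ - κ)) * t ^ (a - 1 - κ / 2) * ‖x - x'‖ ^ κ) := by
  obtain ⟨C₁, hC₁, hD1⟩ := exists_norm_fderiv_oseenSlice_le (E := E)
  obtain ⟨Cκ, hCκ, hDκ⟩ := exists_norm_fderiv_oseenSlice_sub_le (E := E)
  obtain ⟨Cg, hCg, hG⟩ := exists_holder_fderiv_oseenSlice_sub_le_two (E := E)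
  refine ⟨16 * (C₁ + Cκ + Cg), by positivity, ?_⟩
  intro u v hum hvm t a γ κ P Q ht ht1 ha ha1 hγ hγ1 hκ0 hκγ hP0 hQ0 Mu Mv Hu Hv hMum hMvm hHum hHvm
    huc hvc hu hv hHu0 hHv0 hHu hHv hP hQ
  have ht2 : 0 < t / 2 := by positivity
  have hκ1 : κ ≤ 1 := by linarith
  have hMu0 : ∀ τ ∈ Ioo 0 t, 0 ≤ Mu τ := fun τ hτ => (norm_nonneg _).trans (hu τ hτ 0)
  have hMv0 : ∀ τ ∈ Ioo 0 t, 0 ≤ Mv τ := fun τ hτ => (norm_nonneg _).trans (hv τ hτ 0)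
  have hdom := integrableOn_weight_of_profile ht ha ha1 hMum hMvm hMu0 hMv0 hP
  have hslm : ∀ τ, Measurable (u τ) ∧ Measurable (v τ) := fun τ =>
    ⟨hum.comp (measurable_const.prodMk measurable_id), hvm.comp (measurable_const.prodMk measurable_id)⟩
  -- the decomposition of `(0, t)`
  have hunion : Ioo 0 (t / 2) ∪ Ico (t / 2) t = Ioo 0 t := Ioo_union_Ico_eq_Ioo ht2 (by linarith)
  have hdisj : Disjoint (Ioo 0 (t / 2)) (Ico (t / 2) t) := by
    rw [Set.disjoint_left]; intro τ h1 h2; exact lt_irrefl _ (h1.2.trans_le h2.1)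
  set S : ℝ → ℝ := fun τ => Hu τ * Mv τ + Mu τ * Hv τ with hS
  have hSm : Measurable S := (hHum.mul hMvm).add (hMum.mul hHvm)
  have hS0 : ∀ τ ∈ Ioo 0 t, 0 ≤ S τ := fun τ hτ =>
    add_nonneg (mul_nonneg (hHu0 τ hτ) (hMv0 τ hτ)) (mul_nonneg (hMu0 τ hτ) (hHv0 τ hτ))
  -- ### slice-level bounds, valid everywhere on `(0, t)`
  have hb_kernel : ∀ τ ∈ Ioo 0 t, ∀ x, ‖fderiv ℝ (oseenSlice (1 * (t - τ)) (u τ) (v τ)) x‖ ≤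
      C₁ * (t - τ) ^ (-(1 : ℝ)) * (Mu τ * Mv τ) := by
    intro τ hτ x
    have h := hD1 (σ := 1 * (t - τ)) (by linarith [hτ.2]) (hslm τ).1 (hslm τ).2 (hu τ hτ) (hv τ hτ) x
    rw [one_mul] at h
    calc _ ≤ C₁ * (t - τ) ^ (-(1 : ℝ)) * Mu τ * Mv τ := by simpa only [one_mul] using h
      _ = _ := by ring
  have hb_gain : ∀ τ ∈ Ioo 0 t, (∀ x, ‖fderiv ℝ (oseenSlice (1 * (t - τ)) (u τ) (v τ)) x‖ ≤
      Cg * (t - τ) ^ (-1 + γ / 2) * S τ) ∧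
      ∀ x x', ‖fderiv ℝ (oseenSlice (1 * (t - τ)) (u τ) (v τ)) x -
        fderiv ℝ (oseenSlice (1 * (t - τ)) (u τ) (v τ)) x'‖ ≤
          2 * Cg * (t - τ) ^ (-1 + γ / 2 - κ / 2) * S τ * ‖x - x'‖ ^ κ := by
    intro τ hτ
    have h := hG (σ := 1 * (t - τ)) (by linarith [hτ.2]) hγ.le hγ1 hκ0 hκ1 (huc τ hτ) (hvc τ hτ)
      (hu τ hτ) (hv τ hτ) (hHu0 τ hτ) (hHv0 τ hτ) (hHu τ hτ) (hHv τ hτ)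
    simp only [one_mul] at h
    simp only [hS, one_mul]
    exact h
  have hh_kernel : ∀ τ ∈ Ioo 0 t, ∀ x x', ‖fderiv ℝ (oseenSlice (1 * (t - τ)) (u τ) (v τ)) x -
      fderiv ℝ (oseenSlice (1 * (t - τ)) (u τ) (v τ)) x'‖ ≤
        Cκ * (t - τ) ^ (-1 - κ / 2) * (Mu τ * Mv τ) * ‖x - x'‖ ^ κ := by
    intro τ hτ x x'
    have h := hDκ (σ := 1 * (t - τ)) (by linarith [hτ.2]) hκ0 hκ1 (hslm τ).1 (hslm τ).2
      (hu τ hτ) (hv τ hτ) x x'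
    rw [one_mul] at h
    calc _ ≤ Cκ * (t - τ) ^ (-1 - κ / 2) * Mu τ * Mv τ * ‖x - x'‖ ^ κ := by simpa only [one_mul] using h
      _ = _ := by ring
  -- ### the piecewise bounds
  set bound : ℝ → ℝ := fun τ => if τ < t / 2 then C₁ * (t - τ) ^ (-(1 : ℝ)) * (Mu τ * Mv τ)
    else Cg * (t - τ) ^ (-1 + γ / 2) * S τ with hbound
  set h : ℝ → ℝ := fun τ => if τ < t / 2 then Cκ * (t - τ) ^ (-1 - κ / 2) * (Mu τ * Mv τ)
    else 2 * Cg * (t - τ) ^ (-1 + γ / 2 - κ / 2) * S τ with hh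
  have hb : ∀ τ ∈ Ioo 0 t, ∀ x, ‖fderiv ℝ (oseenSlice (1 * (t - τ)) (u τ) (v τ)) x‖ ≤ bound τ := by
    intro τ hτ x
    by_cases hlt : τ < t / 2
    · simp only [hbound, if_pos hlt]; exact hb_kernel τ hτ x
    · simp only [hbound, if_neg hlt]; exact (hb_gain τ hτ).1 x
  have hH : ∀ τ ∈ Ioo 0 t, ∀ x x', ‖fderiv ℝ (oseenSlice (1 * (t - τ)) (u τ) (v τ)) x -
      fderiv ℝ (oseenSlice (1 * (t - τ)) (u τ) (v τ)) x'‖ ≤ h τ * ‖x - x'‖ ^ κ := by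
    intro τ hτ x x'
    by_cases hlt : τ < t / 2
    · simp only [hh, if_pos hlt]; exact hh_kernel τ hτ x x'
    · simp only [hh, if_neg hlt]; exact (hb_gain τ hτ).2 x x'
  -- measurability of the pieces
  have hmeas_b : Measurable bound := by
    refine Measurable.ite measurableSet_Iio ?_ ?_
    · exact (measurable_const.mul ((measurable_const.sub measurable_id).pow_const _)).mul
        (hMum.mul hMvm)
    · exact (measurable_const.mul ((measurable_const.sub measurable_id).pow_const _)).mul hSm
  have hmeas_h : Measurable h := by
    refine Measurable.ite measurableSet_Iio ?_ ?_
    · exact (measurable_const.mul ((measurable_const.sub measurable_id).pow_const _)).mul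
        (hMum.mul hMvm)
    · exact (measurable_const.mul ((measurable_const.sub measurable_id).pow_const _)).mul hSm
  -- ### majorants on the two halves
  -- first half: `(t-τ)^{e} ≤ (t/2)^{e}` for `e ≤ 0`
  have hfirst : ∀ {e : ℝ}, e ≤ 0 → ∀ τ ∈ Ioo 0 (t / 2), (t - τ) ^ e ≤ (t / 2) ^ e :=
    fun he τ hτ => Real.rpow_le_rpow_of_nonpos ht2 (by linarith [hτ.2]) he
  -- second half: `τ^{e} ≤ (t/2)^{e}` for `e ≤ 0`
  have hsecond : ∀ {e : ℝ}, e ≤ 0 → ∀ τ ∈ Ico (t / 2) t, τ ^ e ≤ (t / 2) ^ e :=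
    fun he τ hτ => Real.rpow_le_rpow_of_nonpos ht2 hτ.1 he
  -- ### integrability and integrals of `bound`
  have hb1_le : ∀ τ ∈ Ioo 0 (t / 2), bound τ ≤ C₁ * (t / 2) ^ (-(1 : ℝ)) * P * τ ^ (a - 1) := by
    intro τ hτ
    have hτ' : τ ∈ Ioo 0 t := ⟨hτ.1, hτ.2.trans (by linarith)⟩
    simp only [hbound, if_pos hτ.2]
    calc C₁ * (t - τ) ^ (-(1 : ℝ)) * (Mu τ * Mv τ) ≤ C₁ * (t / 2) ^ (-(1 : ℝ)) * (P * τ ^ (a - 1)) :=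
          mul_le_mul (mul_le_mul_of_nonneg_left (hfirst (by norm_num) τ hτ) hC₁) (hP τ hτ')
            (mul_nonneg (hMu0 τ hτ') (hMv0 τ hτ')) (by positivity)
      _ = _ := by ring
  have hb2_le : ∀ τ ∈ Ico (t / 2) t, bound τ ≤
      Cg * Q * (t / 2) ^ (a - 1 - γ / 2) * (t - τ) ^ (-1 + γ / 2) := by
    intro τ hτ
    have hτ' : τ ∈ Ioo 0 t := ⟨ht2.trans_le hτ.1, hτ.2⟩
    have hnlt : ¬ τ < t / 2 := not_lt.2 hτ.1
    simp only [hbound, if_neg hnlt]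
    have h1 : S τ ≤ Q * (t / 2) ^ (a - 1 - γ / 2) :=
      (hQ τ hτ').trans (mul_le_mul_of_nonneg_left (hsecond (by linarith) τ hτ) hQ0)
    calc Cg * (t - τ) ^ (-1 + γ / 2) * S τ ≤ Cg * (t - τ) ^ (-1 + γ / 2) * (Q * (t / 2) ^ (a - 1 - γ / 2)) :=
          mul_le_mul_of_nonneg_left h1 (mul_nonneg hCg (Real.rpow_nonneg (by linarith [hτ.2]) _))
      _ = _ := by ring
  have hb0 : ∀ τ ∈ Ioo 0 t, 0 ≤ bound τ := fun τ hτ => (norm_nonneg _).trans (hb τ hτ 0)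
  have hbi1 : IntegrableOn bound (Ioo 0 (t / 2)) volume := by
    refine Integrable.mono' ((integrableOn_rpow_Ioo (by linarith : (-1:ℝ) < a - 1)).const_mul
      (C₁ * (t / 2) ^ (-(1 : ℝ)) * P)) hmeas_b.aestronglyMeasurable ?_
    refine (ae_restrict_iff' measurableSet_Ioo).2 (Eventually.of_forall fun τ hτ => ?_)
    rw [Real.norm_eq_abs, abs_of_nonneg (hb0 τ ⟨hτ.1, hτ.2.trans (by linarith)⟩)]
    exact hb1_le τ hτ
  have hbi2 : IntegrableOn bound (Ico (t / 2) t) volume := by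
    rw [integrableOn_Ico_iff_integrableOn_Ioo]
    refine Integrable.mono' ((integrableOn_sub_rpow_Ioo (by linarith : (-1:ℝ) < -1 + γ / 2)).const_mul
      (Cg * Q * (t / 2) ^ (a - 1 - γ / 2))) hmeas_b.aestronglyMeasurable ?_
    refine (ae_restrict_iff' measurableSet_Ioo).2 (Eventually.of_forall fun τ hτ => ?_)
    rw [Real.norm_eq_abs, abs_of_nonneg (hb0 τ ⟨ht2.trans hτ.1, hτ.2⟩)]
    exact hb2_le τ ⟨hτ.1.le, hτ.2⟩
  have hbi : IntegrableOn bound (Ioo 0 t) volume := by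
    rw [← hunion]; exact hbi1.union hbi2
  have hint_b : ∫ τ in Ioo 0 t, bound τ ≤ 8 * (C₁ + Cκ + Cg) * (P / a + Q / γ) * t ^ (a - 1) := by
    rw [← hunion, setIntegral_union hdisj measurableSet_Ico hbi1 hbi2]
    have i1 : ∫ τ in Ioo 0 (t / 2), bound τ ≤ C₁ * (t / 2) ^ (-(1 : ℝ)) * P * ((t / 2) ^ a / a) := by
      calc ∫ τ in Ioo 0 (t / 2), bound τ ≤ ∫ τ in Ioo 0 (t / 2), C₁ * (t / 2) ^ (-(1 : ℝ)) * P * τ ^ (a - 1) :=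
            setIntegral_mono_on hbi1 ((integrableOn_rpow_Ioo (by linarith : (-1:ℝ) < a - 1)).const_mul _)
              measurableSet_Ioo hb1_le
        _ = C₁ * (t / 2) ^ (-(1 : ℝ)) * P * ((t / 2) ^ a / a) := by
            rw [integral_const_mul, setIntegral_Ioo_half_rpow ht ha]
    have i2 : ∫ τ in Ico (t / 2) t, bound τ ≤
        Cg * Q * (t / 2) ^ (a - 1 - γ / 2) * ((t / 2) ^ (-1 + γ / 2 + 1) / (-1 + γ / 2 + 1)) := by
      rw [integral_Ico_eq_integral_Ioo]
      calc ∫ τ in Ioo (t / 2) t, bound τ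
          ≤ ∫ τ in Ioo (t / 2) t, Cg * Q * (t / 2) ^ (a - 1 - γ / 2) * (t - τ) ^ (-1 + γ / 2) :=
            setIntegral_mono_on (by rw [← integrableOn_Ico_iff_integrableOn_Ioo]; exact hbi2)
              ((integrableOn_sub_rpow_Ioo (by linarith : (-1:ℝ) < -1 + γ / 2)).const_mul _)
              measurableSet_Ioo (fun τ hτ => hb2_le τ ⟨hτ.1.le, hτ.2⟩)
        _ = _ := by rw [integral_const_mul, setIntegral_Ioo_half_sub_rpow ht (by linarith)]
    -- powers of `t/2`
    have p1 : (t / 2) ^ (-(1 : ℝ)) * (t / 2) ^ a = (t / 2) ^ (a - 1) := by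
      rw [← Real.rpow_add ht2]; congr 1; ring
    have p2 : (t / 2) ^ (a - 1 - γ / 2) * (t / 2) ^ (-1 + γ / 2 + 1) = (t / 2) ^ (a - 1) := by
      rw [← Real.rpow_add ht2]; congr 1; ring
    have p3 : (t / 2) ^ (a - 1) ≤ 4 * t ^ (a - 1) := half_rpow_le_four_mul ht (by linarith)
    have e2 : (-1 + γ / 2 + 1 : ℝ) = γ / 2 := by ring
    have hta : 0 ≤ t ^ (a - 1) := Real.rpow_nonneg ht.le _
    calc (∫ τ in Ioo 0 (t / 2), bound τ) + ∫ τ in Ico (t / 2) t, bound τ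
        ≤ C₁ * (t / 2) ^ (-(1 : ℝ)) * P * ((t / 2) ^ a / a) +
          Cg * Q * (t / 2) ^ (a - 1 - γ / 2) * ((t / 2) ^ (-1 + γ / 2 + 1) / (-1 + γ / 2 + 1)) :=
          add_le_add i1 i2
      _ = (C₁ * P / a) * ((t / 2) ^ (-(1 : ℝ)) * (t / 2) ^ a) +
          (Cg * Q / (γ / 2)) * ((t / 2) ^ (a - 1 - γ / 2) * (t / 2) ^ (-1 + γ / 2 + 1)) := by
          rw [e2]; ring
      _ = (C₁ * P / a + 2 * Cg * Q / γ) * (t / 2) ^ (a - 1) := by rw [p1, p2]; ring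
      _ ≤ (C₁ * P / a + 2 * Cg * Q / γ) * (4 * t ^ (a - 1)) :=
          mul_le_mul_of_nonneg_left p3 (by positivity)
      _ ≤ 8 * (C₁ + Cκ + Cg) * (P / a + Q / γ) * t ^ (a - 1) := by
          have h1 : 0 ≤ P / a := by positivity
          have h2 : 0 ≤ Q / γ := by positivity
          have key : (C₁ * P / a + 2 * Cg * Q / γ) * 4 ≤ 8 * (C₁ + Cκ + Cg) * (P / a + Q / γ) := by
            have e : (C₁ * P / a + 2 * Cg * Q / γ) * 4 = 4 * C₁ * (P / a) + 8 * Cg * (Q / γ) := by ring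
            rw [e]
            have x1 : 4 * C₁ * (P / a) ≤ 8 * (C₁ + Cκ + Cg) * (P / a) :=
              mul_le_mul_of_nonneg_right (by linarith) h1
            have x2 : 8 * Cg * (Q / γ) ≤ 8 * (C₁ + Cκ + Cg) * (Q / γ) :=
              mul_le_mul_of_nonneg_right (by linarith) h2
            linarith
          calc (C₁ * P / a + 2 * Cg * Q / γ) * (4 * t ^ (a - 1))
              = ((C₁ * P / a + 2 * Cg * Q / γ) * 4) * t ^ (a - 1) := by ring
            _ ≤ (8 * (C₁ + Cκ + Cg) * (P / a + Q / γ)) * t ^ (a - 1) :=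
                mul_le_mul_of_nonneg_right key hta
            _ = _ := by ring
  -- ### integrability and integral of `h`
  have hh1_le : ∀ τ ∈ Ioo 0 (t / 2), h τ ≤ Cκ * (t / 2) ^ (-1 - κ / 2) * P * τ ^ (a - 1) := by
    intro τ hτ
    have hτ' : τ ∈ Ioo 0 t := ⟨hτ.1, hτ.2.trans (by linarith)⟩
    simp only [hh, if_pos hτ.2]
    calc Cκ * (t - τ) ^ (-1 - κ / 2) * (Mu τ * Mv τ) ≤ Cκ * (t / 2) ^ (-1 - κ / 2) * (P * τ ^ (a - 1)) :=
          mul_le_mul (mul_le_mul_of_nonneg_left (hfirst (by linarith) τ hτ) hCκ) (hP τ hτ')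
            (mul_nonneg (hMu0 τ hτ') (hMv0 τ hτ')) (by positivity)
      _ = _ := by ring
  have hh2_le : ∀ τ ∈ Ico (t / 2) t, h τ ≤
      2 * Cg * Q * (t / 2) ^ (a - 1 - γ / 2) * (t - τ) ^ (-1 + γ / 2 - κ / 2) := by
    intro τ hτ
    have hτ' : τ ∈ Ioo 0 t := ⟨ht2.trans_le hτ.1, hτ.2⟩
    have hnlt : ¬ τ < t / 2 := not_lt.2 hτ.1
    simp only [hh, if_neg hnlt]
    have h1 : S τ ≤ Q * (t / 2) ^ (a - 1 - γ / 2) :=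
      (hQ τ hτ').trans (mul_le_mul_of_nonneg_left (hsecond (by linarith) τ hτ) hQ0)
    calc 2 * Cg * (t - τ) ^ (-1 + γ / 2 - κ / 2) * S τ
        ≤ 2 * Cg * (t - τ) ^ (-1 + γ / 2 - κ / 2) * (Q * (t / 2) ^ (a - 1 - γ / 2)) :=
          mul_le_mul_of_nonneg_left h1 (mul_nonneg (by positivity) (Real.rpow_nonneg (by linarith [hτ.2]) _))
      _ = _ := by ring
  have hh0 : ∀ τ ∈ Ioo 0 t, 0 ≤ h τ := by
    intro τ hτ
    have := hH τ hτ 0 0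
    by_cases hlt : τ < t / 2
    · simp only [hh, if_pos hlt]
      exact mul_nonneg (mul_nonneg hCκ (Real.rpow_nonneg (by linarith [hτ.2]) _))
        (mul_nonneg (hMu0 τ hτ) (hMv0 τ hτ))
    · simp only [hh, if_neg hlt]
      exact mul_nonneg (mul_nonneg (by positivity) (Real.rpow_nonneg (by linarith [hτ.2]) _)) (hS0 τ hτ)
  have hhi1 : IntegrableOn h (Ioo 0 (t / 2)) volume := by
    refine Integrable.mono' ((integrableOn_rpow_Ioo (by linarith : (-1:ℝ) < a - 1)).const_mul
      (Cκ * (t / 2) ^ (-1 - κ / 2) * P)) hmeas_h.aestronglyMeasurable ?_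
    refine (ae_restrict_iff' measurableSet_Ioo).2 (Eventually.of_forall fun τ hτ => ?_)
    rw [Real.norm_eq_abs, abs_of_nonneg (hh0 τ ⟨hτ.1, hτ.2.trans (by linarith)⟩)]
    exact hh1_le τ hτ
  have hhi2 : IntegrableOn h (Ico (t / 2) t) volume := by
    rw [integrableOn_Ico_iff_integrableOn_Ioo]
    refine Integrable.mono' ((integrableOn_sub_rpow_Ioo
      (by linarith : (-1:ℝ) < -1 + γ / 2 - κ / 2)).const_mul
      (2 * Cg * Q * (t / 2) ^ (a - 1 - γ / 2))) hmeas_h.aestronglyMeasurable ?_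
    refine (ae_restrict_iff' measurableSet_Ioo).2 (Eventually.of_forall fun τ hτ => ?_)
    rw [Real.norm_eq_abs, abs_of_nonneg (hh0 τ ⟨ht2.trans hτ.1, hτ.2⟩)]
    exact hh2_le τ ⟨hτ.1.le, hτ.2⟩
  have hhi : IntegrableOn h (Ioo 0 t) volume := by
    rw [← hunion]; exact hhi1.union hhi2
  have hint_h : ∫ τ in Ioo 0 t, h τ ≤ 16 * (C₁ + Cκ + Cg) * (P / a + Q / (γ - κ)) * t ^ (a - 1 - κ / 2) := by
    rw [← hunion, setIntegral_union hdisj measurableSet_Ico hhi1 hhi2]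
    have hγκ : 0 < γ - κ := by linarith
    have i1 : ∫ τ in Ioo 0 (t / 2), h τ ≤ Cκ * (t / 2) ^ (-1 - κ / 2) * P * ((t / 2) ^ a / a) := by
      calc ∫ τ in Ioo 0 (t / 2), h τ ≤ ∫ τ in Ioo 0 (t / 2), Cκ * (t / 2) ^ (-1 - κ / 2) * P * τ ^ (a - 1) :=
            setIntegral_mono_on hhi1 ((integrableOn_rpow_Ioo (by linarith : (-1:ℝ) < a - 1)).const_mul _)
              measurableSet_Ioo hh1_le
        _ = _ := by rw [integral_const_mul, setIntegral_Ioo_half_rpow ht ha]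
    have i2 : ∫ τ in Ico (t / 2) t, h τ ≤ 2 * Cg * Q * (t / 2) ^ (a - 1 - γ / 2) *
        ((t / 2) ^ (-1 + γ / 2 - κ / 2 + 1) / (-1 + γ / 2 - κ / 2 + 1)) := by
      rw [integral_Ico_eq_integral_Ioo]
      calc ∫ τ in Ioo (t / 2) t, h τ
          ≤ ∫ τ in Ioo (t / 2) t, 2 * Cg * Q * (t / 2) ^ (a - 1 - γ / 2) * (t - τ) ^ (-1 + γ / 2 - κ / 2) :=
            setIntegral_mono_on (by rw [← integrableOn_Ico_iff_integrableOn_Ioo]; exact hhi2)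
              ((integrableOn_sub_rpow_Ioo (by linarith : (-1:ℝ) < -1 + γ / 2 - κ / 2)).const_mul _)
              measurableSet_Ioo (fun τ hτ => hh2_le τ ⟨hτ.1.le, hτ.2⟩)
        _ = _ := by rw [integral_const_mul, setIntegral_Ioo_half_sub_rpow ht (by linarith)]
    have p1 : (t / 2) ^ (-1 - κ / 2) * (t / 2) ^ a = (t / 2) ^ (a - 1 - κ / 2) := by
      rw [← Real.rpow_add ht2]; congr 1; ring
    have p2 : (t / 2) ^ (a - 1 - γ / 2) * (t / 2) ^ (-1 + γ / 2 - κ / 2 + 1) = (t / 2) ^ (a - 1 - κ / 2) := by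
      rw [← Real.rpow_add ht2]; congr 1; ring
    have p3 : (t / 2) ^ (a - 1 - κ / 2) ≤ 4 * t ^ (a - 1 - κ / 2) :=
      half_rpow_le_four_mul ht (by linarith)
    have e2 : (-1 + γ / 2 - κ / 2 + 1 : ℝ) = (γ - κ) / 2 := by ring
    have hta : 0 ≤ t ^ (a - 1 - κ / 2) := Real.rpow_nonneg ht.le _
    calc (∫ τ in Ioo 0 (t / 2), h τ) + ∫ τ in Ico (t / 2) t, h τ
        ≤ Cκ * (t / 2) ^ (-1 - κ / 2) * P * ((t / 2) ^ a / a) + 2 * Cg * Q * (t / 2) ^ (a - 1 - γ / 2) *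
            ((t / 2) ^ (-1 + γ / 2 - κ / 2 + 1) / (-1 + γ / 2 - κ / 2 + 1)) := add_le_add i1 i2
      _ = (Cκ * P / a) * ((t / 2) ^ (-1 - κ / 2) * (t / 2) ^ a) +
          (2 * Cg * Q / ((γ - κ) / 2)) * ((t / 2) ^ (a - 1 - γ / 2) * (t / 2) ^ (-1 + γ / 2 - κ / 2 + 1)) := by
          rw [e2]; ring
      _ = (Cκ * P / a + 4 * Cg * Q / (γ - κ)) * (t / 2) ^ (a - 1 - κ / 2) := by
          rw [p1, p2]; field_simp; ring
      _ ≤ (Cκ * P / a + 4 * Cg * Q / (γ - κ)) * (4 * t ^ (a - 1 - κ / 2)) :=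
          mul_le_mul_of_nonneg_left p3 (by positivity)
      _ ≤ 16 * (C₁ + Cκ + Cg) * (P / a + Q / (γ - κ)) * t ^ (a - 1 - κ / 2) := by
          have h1 : 0 ≤ P / a := by positivity
          have h2 : 0 ≤ Q / (γ - κ) := by positivity
          have key : (Cκ * P / a + 4 * Cg * Q / (γ - κ)) * 4 ≤
              16 * (C₁ + Cκ + Cg) * (P / a + Q / (γ - κ)) := by
            have e : (Cκ * P / a + 4 * Cg * Q / (γ - κ)) * 4 =
                4 * Cκ * (P / a) + 16 * Cg * (Q / (γ - κ)) := by ring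
            rw [e]
            have x1 : 4 * Cκ * (P / a) ≤ 16 * (C₁ + Cκ + Cg) * (P / a) :=
              mul_le_mul_of_nonneg_right (by linarith) h1
            have x2 : 16 * Cg * (Q / (γ - κ)) ≤ 16 * (C₁ + Cκ + Cg) * (Q / (γ - κ)) :=
              mul_le_mul_of_nonneg_right (by linarith) h2
            linarith
          calc (Cκ * P / a + 4 * Cg * Q / (γ - κ)) * (4 * t ^ (a - 1 - κ / 2))
              = ((Cκ * P / a + 4 * Cg * Q / (γ - κ)) * 4) * t ^ (a - 1 - κ / 2) := by ring
            _ ≤ (16 * (C₁ + Cκ + Cg) * (P / a + Q / (γ - κ))) * t ^ (a - 1 - κ / 2) :=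
                mul_le_mul_of_nonneg_right key hta
            _ = _ := by ring
  -- ### conclusions
  have hsum0 : 0 ≤ C₁ + Cκ + Cg := by positivity
  refine ⟨fun x => hasFDerivAt_oseenDuhamel hum hvm hu hv hdom hb hbi x, fun x => ?_, fun x x' => ?_⟩
  · have hnn : 0 ≤ (P / a + Q / γ) * t ^ (a - 1) :=
      mul_nonneg (add_nonneg (div_nonneg hP0 ha.le) (div_nonneg hQ0 hγ.le)) (Real.rpow_nonneg ht.le _)
    calc ‖fderiv ℝ (fun y => oseenDuhamel 1 0 u v t y) x‖ ≤ ∫ τ in Ioo 0 t, bound τ :=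
          norm_fderiv_oseenDuhamel_le hum hvm hu hv hdom hb hbi x
      _ ≤ 8 * (C₁ + Cκ + Cg) * (P / a + Q / γ) * t ^ (a - 1) := hint_b
      _ = (8 * (C₁ + Cκ + Cg)) * ((P / a + Q / γ) * t ^ (a - 1)) := by ring
      _ ≤ (16 * (C₁ + Cκ + Cg)) * ((P / a + Q / γ) * t ^ (a - 1)) :=
          mul_le_mul_of_nonneg_right (by linarith) hnn
      _ = 16 * (C₁ + Cκ + Cg) * (P / a + Q / γ) * t ^ (a - 1) := by ring
  · calc ‖fderiv ℝ (fun y => oseenDuhamel 1 0 u v t y) x - fderiv ℝ (fun y => oseenDuhamel 1 0 u v t y) x'‖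
          ≤ (∫ τ in Ioo 0 t, h τ) * ‖x - x'‖ ^ κ :=
          norm_fderiv_oseenDuhamel_sub_le hum hvm hu hv hdom hb hbi hH hhi x x'
      _ ≤ 16 * (C₁ + Cκ + Cg) * (P / a + Q / (γ - κ)) * t ^ (a - 1 - κ / 2) * ‖x - x'‖ ^ κ :=
          mul_le_mul_of_nonneg_right hint_h (Real.rpow_nonneg (norm_nonneg _) _)

end Profile

end Literature.Analysis.FluidPDE
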